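import Literature.Geometry.Kaehler.ComplexTorusMixedHardLefschetzKeyLemma
import HarnessLib

/-!
# The mixed hard Lefschetz theorem on a complex torus ABOVE the critical degree:
# `L_{ω_1} ⋯ L_{ω_r} : Hᵏ(X, ℂ) → H^{k+2r}(X, ℂ)` is SURJECTIVE for every `k ≥ g - r` — the Poincaré-dual of
# Cattani's key lemma — and the rank and kernel of the mixed Lefschetz operator in every degree
# (Cattani 2008 Thm. 1.3 / Lemma 4.1 / Thm. 4.2 with Poincaré duality)

Layer `Literature/Geometry/Kaehler`, namespace `Literature.Geometry.Kaehler.ComplexTorus`; lane `lit-hodgefound`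
(Track 2 foundations library, Layer A: Hodge theory of complex tori on invariant forms), seat p16, generation 26
(row g26-#6). Sequel of g26-#4 `ComplexTorusMixedHardLefschetzKeyLemma` (`mixedLefschetz_injective_of_le`: the mixed
Lefschetz operator `L_θ = (-θ_1)_ℂ ∧ ⋯ ∧ (-θ_r)_ℂ ∧ ·` of a positive tuple is injective on `Hᵏ(X, ℂ)` for every
`k + r ≤ g`; Cattani's Lemma 4.1), of g26-#1 `ComplexTorusMixedHodgeIndexAllDegrees` (bijective for `k + r = g`,
Cattani's Thm. 1.3 / 4.2) and of `ComplexTorusPoincareDuality` (`poincarePairing Φ e h : Hᵏ × Hˡ → ℂ`, `k + l = 2g`, a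
perfect pairing: `poincarePairing_isPerfPair`, `eq_zero_of_forall_left_poincarePairing_eq_zero`).

## The sources, verbatim

* E. Cattani, *Mixed Lefschetz theorems and Hodge–Riemann bilinear relations*, IMRN 2008 (arXiv:0707.1352), held
  `paper:arxiv-0707.1352`, §1 p. 3, **Thm. 1.3 (Mixed HLT)**: "Let `ω_1, …, ω_{k-m}` be Kähler classes in the compact
  Kähler manifold `X` [of dimension `k`]. Then the map `L_{ω_1} ⋯ L_{ω_{k-m}} : Hᵐ(X, ℂ) → H^{2k-m}(X, ℂ)` is an
  isomorphism"; §4 p. 10, **Lemma 4.1**: "`ker(T_1 ⋯ T_m) ⊂ W_{m-1} = ⊕_{ℓ ≤ m-1} V_ℓ`"; **Thm. 4.2**: "the map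
  `T_1 ⋯ T_m : V_m → V_{-m}` is an isomorphism. *Proof.* By Lemma 4.1, the map […] is `1:1`. Since `dim V_m = dim V_{-m}`,
  the result follows"; §2 **Def. 2.1**/p. 5: "`Q` a non-degenerate real bilinear form of parity `(-1)^k`", `𝔤_a ⊂
  𝔬_{-2}(V, Q)` ("infinitesimal automorphisms of `(V, Q)`": `Q(Tu, v) + Q(u, Tv) = 0`), Example: "given `Q` as in (1)"
  — `Q(α, β) = … ∫_X α ∪ β` — "[…] `(V_*, Q, 𝔤_a, L_ω)` is a polarized Hodge-Lefschetz module".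
* H. Lange, *Abelian Varieties over the Complex Numbers* (2023), §6.2.4 (p. 310; Poincaré duality `Hᵏ ≅ (H^{2g-k})^*`
  on a complex torus via `∫_X α ∧ β`), §1.1.5 Prop. 1.1.23 (`b_k = C(2g, k)`).

What is proved here is the Poincaré-dual reading of Lemma 4.1, which Cattani's `Q`-self-adjointness of the `T_j`
(elements of `𝔬(V, Q)`) makes automatic in a Hodge–Lefschetz module and which on the torus is the graded
commutativity of `∧` under `∫_X`: **`L_θ` is `∫`-self-adjoint** (`⟨L_θ A, δ⟩ = ⟨A, L_θ δ⟩`, the monomial having even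
degree), hence `L_θ : Hᵏ → H^{k+2r}` is surjective exactly when its transpose `L_θ : H^{2g-k-2r} → H^{2g-k}` is
injective, i.e. (Lemma 4.1) when `(2g-k-2r) + r ≤ g`, i.e. **for every `k ≥ g - r`** (`k + 2r ≤ 2g`). With g26-#4 this
gives the mixed Lefschetz operator's rank in every degree — `min(b_k, b_{k+2r})` — and the dimension of the mixed
primitive spaces `ker L_θ ∩ Hᵏ` for every length `r` with `k + r ≥ g`: `b_k - b_{k+2r}`.

## Contents (theorems only; no `sorry`, no definition, no named fact, net debt 0)

* §1 **`poincarePairing_mixedLefschetz`** — `⟨L_Θ A, δ⟩ = ⟨A, L_Θ δ⟩` for any family `Θ` of complex `2`-forms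
  (`A ∈ Hᵏ`, `δ ∈ Hˡ`, `k + l + 2r = 2g`): the mixed Lefschetz operator is self-adjoint for the Poincaré pairing
  (`wedge_mixedLefschetz_domDomCongr`: `(Ω ∧ A) ∧ δ = A ∧ (Ω ∧ δ)` as top forms).
* §2 **`mixedLefschetz_surjective_of_ge`** — CATTANI'S THM. 1.3 ABOVE THE CRITICAL DEGREE: for `s ∈ positiveTuples E r`,
  `g ≤ k + r`, `2r + k = K ≤ 2g`, `L_s : Hᵏ(X, ℂ) → Hᴷ(X, ℂ)` is onto (transpose injective by g26-#4, perfect pairing);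
  `exists_wedgeFamily_wedge_eq_of_ge` (every `K`-form is `(-s_1)_ℂ ∧ ⋯ ∧ (-s_r)_ℂ ∧ A`), `range_mixedLefschetz_eq_top_of_ge`.
* §3 Ranks and kernels in every degree: `finrank_range_mixedLefschetz_of_ge` (`= b_K = C(2g, K)`),
  **`finrank_ker_mixedLefschetz_of_ge`** / **`finrank_mixedPrimitiveForms_of_ge`** (`dim(ker L_s ∩ Hᵏ) = C(2g, k) -
  C(2g, k+2r)` for `k + r ≥ g` — the mixed primitive space of T2 for a monomial of ANY length `r`; for `r = n + 1`,
  `k = m + 2`, `n + k = g` this is `C(2g, m+2) - C(2g, m)` by the symmetry `C(2g, 2g-m) = C(2g, m)`,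
  `finrank_mixedPrimitiveForms_of_pos'`, agreeing with g26-#5), and the trichotomy summary
  `mixedLefschetz_injective_or_surjective` (injective for `k + r ≤ g`, surjective for `k + r ≥ g`).

## References

* [Cattani2008MixedLefschetz] E. Cattani, IMRN 2008 (arXiv:0707.1352), Thm. 1.3, §2 Def. 2.1 and Example, §4 Lemma 4.1,
  Thm. 4.2, Thm. 4.3.
* [Lange2023AbelianVarietiesComplex] H. Lange, *Abelian Varieties over the Complex Numbers* (2023), §6.2.4 (p. 310),
  §1.1.5 Prop. 1.1.23.
* [DinhNguyen2006] T.-C. Dinh, V.-A. Nguyên, GAFA 16 (2006), §1 Theorem B, §4 Remarks 4.2 (arXiv PDF pp. 4, 9).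
* [Warner1983] F. Warner, GTM 94, 2.6 (graded commutativity of `∧`).
-/

noncomputable section

open scoped ComplexConjugate ComplexOrder
open Complex Function Module Finset
open Literature.LinearAlgebra.Alternating
open Literature.Analysis.Complex (oneForm₀ IsOfTypeAt typeSubmodule isOfTypeAt_of_mem_typeSubmodule finrank_typeSubmodule
  typeProjAt typeProjₗ typeProjₗ_apply isOfTypeAt_typeProjAt typeProjAt_zero typeProjAt_of_ne sum_antidiagonal_typeProjAt
  finrank_alt_real_complex)

namespace Literature.Geometry.Kaehler

namespace ComplexTorus

universe u

/-! ## §1 `L_Θ` is self-adjoint for the Poincaré pairing -/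

section SelfAdjoint

variable {E : Type u} [NormedAddCommGroup E] [NormedSpace ℂ E]

/-- **`(Ω ∧ A) ∧ δ = A ∧ (Ω ∧ δ)` as top forms** (`Ω = Θ_1 ∧ ⋯ ∧ Θ_r` has even degree, so it is central in the
graded-commutative ring of forms). [cite: Warner1983, 2.6] [cite: Cattani2008MixedLefschetz, §2 Def. 2.1 (`T ∈ 𝔬(V, Q)`)] -/
theorem wedge_mixedLefschetz_domDomCongr {r k l K K' N : ℕ} (Θ : Fin r → E [⋀^Fin 2]→L[ℝ] ℂ) (hK : 2 * r + k = K)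
    (hK' : 2 * r + l = K') (h : K + l = N) (h' : k + K' = N) (A : E [⋀^Fin k]→L[ℝ] ℂ) (δ : E [⋀^Fin l]→L[ℝ] ℂ) :
    ((mixedLefschetz Θ hK A).wedge δ).domDomCongr (finCongr h) =
      (A.wedge (mixedLefschetz Θ hK' δ)).domDomCongr (finCongr h') := by
  apply GForm.of_injective N
  rw [GForm.of_domDomCongr_finCongr, GForm.of_domDomCongr_finCongr, ← GForm.of_mul_of, ← GForm.of_mul_of,
    mixedLefschetz_apply, mixedLefschetz_apply, GForm.of_domDomCongr_finCongr, GForm.of_domDomCongr_finCongr,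
    ← GForm.of_mul_of, ← GForm.of_mul_of, ← mul_assoc,
    GForm.of_mul_comm_of_even (even_two_mul r) (wedgeFamily r Θ) (GForm.of k A)]

variable {ι : Type*} [DecidableEq ι] (Φ : (ι → ℝ) ≃L[ℝ] E) {g : ℕ} (e : Fin (2 * g) ≃ ι)

/-- **`⟨L_Θ A, δ⟩ = ⟨A, L_Θ δ⟩`: the mixed Lefschetz operator is self-adjoint for the Poincaré pairing `∫_X · ∧ ·`**
(`A ∈ Hᵏ`, `δ ∈ Hˡ`, `K = k + 2r`, `K' = l + 2r`, `K + l = k + K' = 2g`) — Cattani's `T_j ∈ 𝔤_a ⊂ 𝔬_{-2}(V, Q)` up to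
the sign convention of `Q`, here with the plain cup-product pairing. [cite: Cattani2008MixedLefschetz, §2 Def. 2.1 and Example]
[cite: Lange2023AbelianVarietiesComplex, §6.2.4 (p. 310)] [cite: Warner1983, 2.6] -/
theorem poincarePairing_mixedLefschetz {r k l K K' : ℕ} (Θ : Fin r → E [⋀^Fin 2]→L[ℝ] ℂ) (hK : 2 * r + k = K)
    (hK' : 2 * r + l = K') (h : K + l = 2 * g) (h' : k + K' = 2 * g) (A : E [⋀^Fin k]→L[ℝ] ℂ)
    (δ : E [⋀^Fin l]→L[ℝ] ℂ) :
    poincarePairing Φ e h (mixedLefschetz Θ hK A) δ = poincarePairing Φ e h' A (mixedLefschetz Θ hK' δ) := by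
  rw [poincarePairing_apply, poincarePairing_apply]
  exact congrArg (fun X : E [⋀^Fin (2 * g)]→L[ℝ] ℂ ↦ X (orderedBasis Φ e))
    (wedge_mixedLefschetz_domDomCongr Θ hK hK' h h' A δ)

end SelfAdjoint

/-! ## §2 Surjectivity above the critical degree (the Poincaré dual of Cattani's Lemma 4.1) -/

section Surjective

variable {ι : Type*} [Fintype ι] [DecidableEq ι] {E : Type u} [NormedAddCommGroup E] [NormedSpace ℂ E]
  (Φ : (ι → ℝ) ≃L[ℝ] E) {g : ℕ} (e : Fin (2 * g) ≃ ι)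

include Φ e in
/-- **Cattani's Thm. 1.3 above the critical degree: `L_{ω_1} ⋯ L_{ω_r} : Hᵏ(X, ℂ) → H^{k+2r}(X, ℂ)` is SURJECTIVE for
every `k ≥ g - r`** (`k + 2r ≤ 2g`; `ω_j = -s_j`, `s ∈ positiveTuples E r`, `X = E/Φ(ℤ^ι)` of dimension `g`). Proof: a
functional on `H^{k+2r}` vanishing on the image is `⟨·, δ⟩` for a `δ ∈ H^{2g-k-2r}` (Poincaré duality is perfect);
by self-adjointness `⟨A, L δ⟩ = 0` for all `A`, so `L δ = 0`, and `δ = 0` by the key lemma in degree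
`2g - k - 2r ≤ g - r` (g26-#4). [cite: Cattani2008MixedLefschetz, Thm. 1.3, §4 Lemma 4.1 and Thm. 4.2]
[cite: Lange2023AbelianVarietiesComplex, §6.2.4 (p. 310)] [cite: DinhNguyen2006, §1 Theorem B and §4 Remarks 4.2 (arXiv PDF pp. 4, 9)] -/
theorem mixedLefschetz_surjective_of_ge {r k K : ℕ} (hkr : g ≤ k + r) (hK : 2 * r + k = K) (hK2 : K ≤ 2 * g)
    {s : Fin r → E [⋀^Fin 2]→L[ℝ] ℝ} (hs : s ∈ positiveTuples E r) :
    Function.Surjective (mixedLefschetz (fun j ↦ ofRealForm (-(s j))) (m := k) hK) := by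
  haveI := finiteDimensional_complex Φ
  have hg : finrank ℂ E = g := finrank_eq_of_finTwoMulEquiv Φ e
  obtain ⟨l, hl⟩ : ∃ l, K + l = 2 * g := ⟨2 * g - K, by omega⟩
  have hK' : 2 * r + l = 2 * g - k := by omega
  have h' : k + (2 * g - k) = 2 * g := by omega
  have hinj : Function.Injective (mixedLefschetz (fun j ↦ ofRealForm (-(s j))) (m := l) hK') :=
    mixedLefschetz_injective_of_le hg (by omega) hK' hs
  rw [← LinearMap.dualMap_injective_iff, injective_iff_map_eq_zero]
  intro φ hφ
  obtain ⟨δ, rfl⟩ := (LinearMap.IsPerfPair.bijective_right (poincarePairing Φ e hl)).2 φ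
  have hδ : mixedLefschetz (fun j ↦ ofRealForm (-(s j))) (m := l) hK' δ = 0 := by
    refine eq_zero_of_forall_left_poincarePairing_eq_zero Φ e h' fun A ↦ ?_
    rw [← poincarePairing_mixedLefschetz Φ e _ hK hK' hl h' A δ]
    have h0 := LinearMap.congr_fun hφ A
    rwa [LinearMap.dualMap_apply, LinearMap.zero_apply, LinearMap.flip_apply] at h0
  rw [hinj (hδ.trans (map_zero _).symm), map_zero]

include Φ e in
/-- `range L_s = H^{k+2r}(X, ℂ)` for `k ≥ g - r`. [cite: Cattani2008MixedLefschetz, Thm. 1.3 and §4 Lemma 4.1] -/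
theorem range_mixedLefschetz_eq_top_of_ge {r k K : ℕ} (hkr : g ≤ k + r) (hK : 2 * r + k = K) (hK2 : K ≤ 2 * g)
    {s : Fin r → E [⋀^Fin 2]→L[ℝ] ℝ} (hs : s ∈ positiveTuples E r) :
    LinearMap.range (mixedLefschetz (fun j ↦ ofRealForm (-(s j))) (m := k) hK) = ⊤ :=
  LinearMap.range_eq_top.2 (mixedLefschetz_surjective_of_ge Φ e hkr hK hK2 hs)

include Φ e in
/-- **In the language of forms: every complex `(2r+k)`-form is `(-s_1)_ℂ ∧ ⋯ ∧ (-s_r)_ℂ ∧ A`** for some complex `k`-form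
`A`, as soon as `k + r ≥ g` (and `k + 2r ≤ 2g`). [cite: Cattani2008MixedLefschetz, Thm. 1.3] [cite: DinhNguyen2006, §1 Theorem B (arXiv PDF p. 4)] -/
theorem exists_wedgeFamily_wedge_eq_of_ge {r k : ℕ} (hkr : g ≤ k + r) (hK2 : 2 * r + k ≤ 2 * g)
    {s : Fin r → E [⋀^Fin 2]→L[ℝ] ℝ} (hs : s ∈ positiveTuples E r) (B : E [⋀^Fin (2 * r + k)]→L[ℝ] ℂ) :
    ∃ A : E [⋀^Fin k]→L[ℝ] ℂ, (wedgeFamily r fun j ↦ ofRealForm (-(s j))).wedge A = B := by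
  obtain ⟨A, hA⟩ := mixedLefschetz_surjective_of_ge Φ e hkr rfl hK2 hs B
  rw [mixedLefschetz_apply, domDomCongr_finCongr_self] at hA
  exact ⟨A, hA⟩

end Surjective

/-! ## §3 Rank and kernel of the mixed Lefschetz operator in every degree -/

section Rank

variable {ι : Type*} [Fintype ι] [DecidableEq ι] {E : Type u} [NormedAddCommGroup E] [NormedSpace ℂ E]
  (Φ : (ι → ℝ) ≃L[ℝ] E) {g : ℕ} (e : Fin (2 * g) ≃ ι)

include Φ e in
/-- **`rank(L_s : Hᵏ → H^{k+2r}) = b_{k+2r} = C(2g, k+2r)` for `k ≥ g - r`.** [cite: Cattani2008MixedLefschetz, Thm. 1.3 and §4 Lemma 4.1]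
[cite: Lange2023AbelianVarietiesComplex, §1.1.5 Prop. 1.1.23] -/
theorem finrank_range_mixedLefschetz_of_ge {r k K : ℕ} (hkr : g ≤ k + r) (hK : 2 * r + k = K) (hK2 : K ≤ 2 * g)
    {s : Fin r → E [⋀^Fin 2]→L[ℝ] ℝ} (hs : s ∈ positiveTuples E r) :
    finrank ℂ (LinearMap.range (mixedLefschetz (fun j ↦ ofRealForm (-(s j))) (m := k) hK)) = (2 * g).choose K := by
  haveI := finiteDimensional_complex Φ
  rw [range_mixedLefschetz_eq_top_of_ge Φ e hkr hK hK2 hs, finrank_top, finrank_alt_real_complex,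
    finrank_eq_of_finTwoMulEquiv Φ e]

include Φ e in
/-- **`dim ker(L_s : Hᵏ → H^{k+2r}) = b_k - b_{k+2r} = C(2g, k) - C(2g, k+2r)` for `k ≥ g - r`** (rank–nullity).
[cite: Cattani2008MixedLefschetz, Thm. 1.3 and §4 Thm. 4.3] [cite: Lange2023AbelianVarietiesComplex, §1.1.5 Prop. 1.1.23] -/
theorem finrank_ker_mixedLefschetz_of_ge {r k K : ℕ} (hkr : g ≤ k + r) (hK : 2 * r + k = K) (hK2 : K ≤ 2 * g)
    {s : Fin r → E [⋀^Fin 2]→L[ℝ] ℝ} (hs : s ∈ positiveTuples E r) :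
    finrank ℂ (LinearMap.ker (mixedLefschetz (fun j ↦ ofRealForm (-(s j))) (m := k) hK)) =
      (2 * g).choose k - (2 * g).choose K := by
  haveI := finiteDimensional_complex Φ
  have h := LinearMap.finrank_range_add_finrank_ker (mixedLefschetz (fun j ↦ ofRealForm (-(s j))) (m := k) hK)
  rw [finrank_range_mixedLefschetz_of_ge Φ e hkr hK hK2 hs, finrank_alt_real_complex, finrank_eq_of_finTwoMulEquiv Φ e] at h
  omega

include Φ e in
/-- **The mixed primitive space for a monomial of ANY length: `dim_ℂ (ker L_s ∩ Hᵏ) = C(2g, k) - C(2g, k+2r)`** for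
`s ∈ positiveTuples E r`, `k + r ≥ g`, `k + 2r ≤ 2g` (T2's `mixedPrimitiveForms`; it is `0` for `k + r ≤ g`, g26-#4
`mixedPrimitiveForms_eq_bot_of_le`). [cite: Cattani2008MixedLefschetz, Thm. 1.3 and §4 Thm. 4.3]
[cite: Lange2023AbelianVarietiesComplex, §1.1.5 Prop. 1.1.23] -/
theorem finrank_mixedPrimitiveForms_of_ge {r k : ℕ} (hkr : g ≤ k + r) (hK2 : 2 * r + k ≤ 2 * g)
    {s : Fin r → E [⋀^Fin 2]→L[ℝ] ℝ} (hs : s ∈ positiveTuples E r) :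
    finrank ℂ (mixedPrimitiveForms (fun j ↦ ofRealForm (-(s j))) k) = (2 * g).choose k - (2 * g).choose (2 * r + k) :=
  finrank_ker_mixedLefschetz_of_ge Φ e hkr rfl hK2 hs

include Φ e in
/-- **Agreement with g26-#5 / Cattani's Thm. 4.3 count**: for a positive tuple `t` of length `n + 1` and degree `m + 2`
with `n + (m+2) = g`, `dim_ℂ P^{m+2}_t(ℂ) = C(2g, m+2) - C(2g, m)` (`C(2g, 2g-m) = C(2g, m)`) — here from surjectivity
and rank–nullity instead of the decomposition. [cite: Cattani2008MixedLefschetz, §4 Thm. 4.3]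
[cite: Lange2023AbelianVarietiesComplex, §1.1.5 Prop. 1.1.23] -/
theorem finrank_mixedPrimitiveForms_of_pos' {n m : ℕ} (hnk : n + (m + 2) = g)
    {t : Fin (n + 1) → E [⋀^Fin 2]→L[ℝ] ℝ} (ht : t ∈ positiveTuples E (n + 1)) :
    finrank ℂ (mixedPrimitiveForms (fun j ↦ ofRealForm (-(t j))) (m + 2)) = (2 * g).choose (m + 2) - (2 * g).choose m := by
  rw [finrank_mixedPrimitiveForms_of_ge Φ e (by omega) (by omega) ht,
    show 2 * (n + 1) + (m + 2) = 2 * g - m by omega, Nat.choose_symm (by omega)]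

include Φ e in
/-- **The trichotomy of Cattani's Thm. 1.3 on the torus, every degree**: `L_s : Hᵏ → H^{k+2r}` is injective when
`k + r ≤ g` (g26-#4) and surjective when `k + r ≥ g` (§2); in the critical degree both (g26-#1).
[cite: Cattani2008MixedLefschetz, Thm. 1.3, §4 Lemma 4.1 and Thm. 4.2] -/
theorem mixedLefschetz_injective_or_surjective {r k K : ℕ} (hK : 2 * r + k = K) (hK2 : K ≤ 2 * g)
    {s : Fin r → E [⋀^Fin 2]→L[ℝ] ℝ} (hs : s ∈ positiveTuples E r) :
    Function.Injective (mixedLefschetz (fun j ↦ ofRealForm (-(s j))) (m := k) hK) ∨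
      Function.Surjective (mixedLefschetz (fun j ↦ ofRealForm (-(s j))) (m := k) hK) := by
  haveI := finiteDimensional_complex Φ
  rcases Nat.lt_or_ge g (k + r) with h | h
  · exact Or.inr (mixedLefschetz_surjective_of_ge Φ e h.le hK hK2 hs)
  · exact Or.inl (mixedLefschetz_injective_of_le (finrank_eq_of_finTwoMulEquiv Φ e) h hK hs)

end Rank

end ComplexTorus

end Literature.Geometry.Kaehler

end
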